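import Literature.Geometry.Lorentzian.CorrespondingBoundaryShadow
import Literature.Geometry.Lorentzian.SubdevelopmentTimelikeEntry
import Literature.Geometry.Lorentzian.CausalityOpennessProofs
import Literature.Geometry.Lorentzian.CauchyHypersurfaceGlobalHyperbolicity
import Literature.Geometry.Lorentzian.NonImprisonmentProofs
import Literature.Geometry.Lorentzian.CausalFutureCompactSet
import Literature.Geometry.Lorentzian.CausalityConditionsProofs
import Literature.Geometry.Lorentzian.CauchyDevelopmentGlobalHyperbolicityProofs
import HarnessLib

/-!
# No corresponding boundary points for the realised domain of dependence of a hypersurface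

Pure causal setting (the instance is a common development `(U ⊆ M₁, ψ : U → M₂)` over a map
`ι₂ : N → M₂` of a Cauchy development `M₁` of the data of an acausal spacelike HYPERSURFACE
`S = ι₂(N)` of a Cauchy development `M₂`, realised over a region `W = ψ(U)` of `M₂` in which `S`
is a Cauchy hypersurface — its domain of dependence; Hawking–Ellis 1973, §7.6,
Choquet-Bruhat–Geroch 1969, p. 334). Two time-oriented Lorentzian manifolds `M₁`, `M₂`; a Cauchy
hypersurface `S₁` of `M₁`; an open `U ⊇ S₁` in which `S₁` is a Cauchy hypersurface; an ACHRONAL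
set `S ⊆ M₂` and an open `W ⊆ M₂` in which `S` is a Cauchy hypersurface; a map `ψ : M₁ → M₂`,
continuous, injective and open on `U`, with `ψ(S₁) = S`, `ψ(U) = W`, transporting timelike segments
(`hpush`, `hpull`). **Theorem (`false_of_corresponding`): `U` and `W` have no corresponding
boundary points** — no `p ∈ ∂U`, `p' ∈ M₂` such that every pair of neighbourhoods `V ∋ p`,
`V' ∋ p'` contains `y ∈ U ∩ V` with `ψ y ∈ V'` (Sbierski 2016, Def. 11) — provided:

* the global-hyperbolicity consequences, displayed in both time directions exactly in the form
  used (compactness of `J∓(x) ∩ J±(S₁)` in `M₁`, of `J±(C) ∩ J∓(x)` for compact `C` in `M₂`;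
  sequential closedness of `≤` in `M₂`; non-imprisonment of past/future-endless causal curves of
  `M₂` in compact sets — Hawking–Ellis 1973, Prop. 6.6.6; O'Neill 1983, Lemma 14.13, 14.22);
* `J⁺(S) ⊆ S ∪ I⁺(S)` and `J⁻(S) ⊆ S ∪ I⁻(S)` (`S` spacelike: O'Neill 1983, Lemma 14.42);
* **(hD±) `W` contains every point `q ∈ I±(S)` all of whose past/future-endless causal curves meet
  `S`** — i.e. `W ⊇ (D⁺(S) ∖ S) ∪ (D⁻(S) ∖ S)` for the Cauchy development `D(S)` of O'Neill 1983,
  Def. 14.35: `W` is (at least) the domain of dependence of `S`.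

**Horizon lemma** (`exists_mem_of_isPastEndless_of_shadow_subset`, proved first): if
`J⁺(S) ⊆ S ∪ I⁺(S)`, `C ⊆ S` is compact and `q ∈ I⁺(S)` has shadow `I⁻(q) ∩ S ⊆ C`, then every
past-endless causal curve `α` from `q` meets `S`. While `α t ∈ I⁺(S)` we have `w ≪ α t ≤ q` for
some `w ∈ S`, so `w ∈ C` and `α t ∈ J⁺(C) ∩ J⁻(q)`, a compact set; if this holds for all `t`, `α`
is imprisoned (against non-imprisonment); otherwise at the last parameter `T` outside `I⁺(S)` the
shadow points below `α u`, `u ↓ T`, accumulate at `w₀ ∈ C` with `w₀ ≤ α T ∉ I⁺(S)`, so `α T ∈ S`.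
Contrapositively the shadow of a point on or beyond the future Cauchy horizon of `S` escapes every
compact subset of `S` (compare Hawking–Ellis 1973, Prop. 6.5.3).

Proof of the future case `p ∈ I⁺(S₁)` (`false_of_corresponding_future`): by
`CorrespondingBoundaryShadow` (`exists_mem_opens_ll_ll`, `mem_causalFuture_glue_of_corresponding`)
`p' ∈ I⁺(ψ r)` for some `r ∈ U ∩ I⁺(S₁)`, hence `p' ∈ I⁺(S)`; the **shadow bound**
`I⁻(p') ∩ S ⊆ ψ(J⁻(p⁺) ∩ S₁)` (`chronologicalPast_inter_subset_image_of_corresponding_hyp`: as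
in the sub-datum case, with "no timelike entry into `W` from `J⁺(S)`",
`IsAchronal.mem_opens_of_mem_chronologicalFuture`, in place of the causal convexity of a region of
a Cauchy hypersurface) exhibits a compact subset of `S` containing the shadow of `p'`; the
**horizon lemma** (`exists_mem_of_isPastEndless_of_shadow_subset`) then makes every past-endless
causal curve from `p'` meet `S`, so `p' ∈ W = ψ(U)` by (hD⁺) — impossible for an injective open
`ψ` and `p ∈ ∂U` (`false_of_mem_image_of_corresponding`). The past case is the future case for
the reversed time orientations.

The last part of the file derives the displayed inputs for Cauchy developments and for a
hypersurface which is Cauchy in an open neighbourhood: `CauchyDevelopment.isCompact_causalFuture_inter_causalPast_of_isCompact`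
(and dual), `CauchyDevelopment.exists_ge_notMem_of_isFutureEndless` (and dual),
`LorentzianMetric.causalFuture_subset_union_chronologicalFuture_of_cauchy_nhds` (and dual):
`J⁺(S) ⊆ S ∪ I⁺(S)` follows from the acausality of `S`, the causality condition and the Cauchy
property of `S` in a neighbourhood `V` (dichotomy `V ∖ S = I⁺_V(S) ⊔ I⁻_V(S)`).

Everything is proved; no definitions, no named facts. Consumer: hypothesis (HDoD) of the
hypersurface sub-data maximality statement of summit `FinalStateConjecture`
(`stub_hypersurfaceMGHDRealised`), reduced by this file to the causal theory of `D(S)` (O'Neill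
1983, Lemma 14.43: `D(S)` is open and `S` is a Cauchy hypersurface of it).

## References

* J. Sbierski, Ann. Henri Poincaré 17 (2016) 301–329 = arXiv:1309.7591v3, §3.2, Def. 11,
  Prop. 13 (arXiv numbering). [Sbierski2016AHP]
* S. W. Hawking, G. F. R. Ellis, *The large scale structure of space-time*, CUP 1973, §6.5–6.6,
  §7.6 pp. 249–251. [HawkingEllis1973CUP]
* B. O'Neill, *Semi-Riemannian geometry with applications to relativity*, Academic Press 1983,
  Ch. 14, Cor. 14.1, Lemma 14.13, 14.22, Def. 14.35, Lemma 14.42–14.43. [ONeillSemiRiemannian1983]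
* Y. Choquet-Bruhat, R. Geroch, Comm. Math. Phys. 14 (1969) 329–335, p. 334.
  [ChoquetBruhatGeroch1969CMP]
-/

noncomputable section

open Set Filter Function TopologicalSpace Topology
open scoped Manifold ContDiff Topology

namespace Literature.Geometry.Lorentzian

namespace LorentzianMetric

/-! ### The horizon lemma -/

section Horizon
variable {E : Type*} [NormedAddCommGroup E] [NormedSpace ℝ E] {H : Type*} [TopologicalSpace H]
  {I : ModelWithCorners ℝ E H} {n : ℕ∞ω} {M : Type*} [TopologicalSpace M] [ChartedSpace H M]
  [IsManifold I ∞ M] [BoundarylessManifold I M] [FiniteDimensional ℝ E]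
  {g : LorentzianMetric I n M} {τ : TimeOrientation g}

/-- **Horizon lemma.** If `J⁺(S) ⊆ S ∪ I⁺(S)`, `C ⊆ S` is compact, `q ∈ I⁺(S)` has shadow
`I⁻(q) ∩ S ⊆ C`, the causal relation is sequentially closed (`hrel`), the sets `J⁺(C) ∩ J⁻(x)` are
compact (`hK`) and past-endless causal curves are not past-imprisoned in compact sets (`himp`),
then every past-endless future causal curve `α` with `α t₀ = q` meets `S` at some parameter
`t ≤ t₀`: `q ∈ D⁺(S)`. See the module docstring for the proof.
[cite: ONeillSemiRiemannian1983, Ch. 14, Def. 14.35 and Lemma 14.13, 14.22 (pp. 407–421)] -/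
theorem exists_mem_of_isPastEndless_of_shadow_subset [SecondCountableTopology M] (hn : 1 ≤ n)
    {S C : Set M} (hCS : C ⊆ S)
    (hC : IsCompact C) (hJS : g.causalFuture τ S ⊆ S ∪ g.chronologicalFuture τ S)
    (hrel : ∀ {xs ys : ℕ → M} {x y : M}, Tendsto xs atTop (𝓝 x) → Tendsto ys atTop (𝓝 y) →
      (∀ j, ys j ∈ g.causalFuture τ {xs j}) → y ∈ g.causalFuture τ {x})
    (hK : ∀ x : M, IsCompact (g.causalFuture τ C ∩ g.causalPast τ {x}))
    (himp : ∀ K : Set M, IsCompact K → ∀ (γ : ℝ → M) (s : Set ℝ), s.OrdConnected →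
      g.IsFutureCausalCurveOn τ γ s → IsPastEndless γ s → ∀ t₀ ∈ s, ∃ t ∈ s, t ≤ t₀ ∧ γ t ∉ K)
    {q : M} (hq : q ∈ g.chronologicalFuture τ S)
    (hshadow : g.chronologicalPast τ {q} ∩ S ⊆ C)
    {α : ℝ → M} {s : Set ℝ} (hs : s.OrdConnected) (hα : g.IsFutureCausalCurveOn τ α s)
    (hend : IsPastEndless α s) {t₀ : ℝ} (ht₀ : t₀ ∈ s) (hαq : α t₀ = q) :
    ∃ t ∈ s, t ≤ t₀ ∧ α t ∈ S := by
  by_contra H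
  push Not at H
  -- `α t ≤ q` for `t ≤ t₀`
  have hle : ∀ t ∈ s, t ≤ t₀ → q ∈ g.causalFuture τ {α t} := by
    intro t ht htt₀
    rcases eq_or_lt_of_le htt₀ with rfl | hlt
    · rw [hαq]; exact subset_causalFuture g τ _ rfl
    · exact Or.inr ⟨α t, rfl, α, t, t₀, hlt, hα.mono (hs.out ht ht₀), rfl, hαq⟩
  -- while in `I⁺(S)`, `α` stays in the compact `K₀ = J⁺(C) ∩ J⁻(q)`
  set K₀ := g.causalFuture τ C ∩ g.causalPast τ {q} with hK₀
  have hshad : ∀ t ∈ s, t ≤ t₀ → ∀ w ∈ S, α t ∈ g.chronologicalFuture τ {w} → w ∈ C := by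
    intro t ht htt₀ w hw hwt
    refine hshadow ⟨mem_chronologicalPast_of_mem_chronologicalFuture ?_, hw⟩
    exact mem_chronologicalFuture_of_mem_chronologicalFuture_of_mem_causalFuture hn hwt
      (hle t ht htt₀)
  have hinK : ∀ t ∈ s, t ≤ t₀ → α t ∈ g.chronologicalFuture τ S → α t ∈ K₀ := by
    intro t ht htt₀ hI
    rw [chronologicalFuture_eq_biUnion] at hI
    simp only [mem_iUnion, exists_prop] at hI
    obtain ⟨w, hw, hwt⟩ := hI
    refine ⟨?_, mem_causalPast_of_mem_causalFuture (hle t ht htt₀)⟩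
    exact causalFuture_mono (singleton_subset_iff.2 (hshad t ht htt₀ w hw hwt))
      (chronologicalFuture_subset_causalFuture g τ _ hwt)
  by_cases hall : ∀ t ∈ s, t ≤ t₀ → α t ∈ g.chronologicalFuture τ S
  · -- imprisoned in `K₀`
    obtain ⟨t, ht, htt₀, hnot⟩ := himp K₀ (hK q) α s hs hα hend t₀ ht₀
    exact hnot (hinK t ht htt₀ (hall t ht htt₀))
  · push Not at hall
    obtain ⟨t₁, ht₁, ht₁t₀, hnot₁⟩ := hall
    -- the last parameter `T ≤ t₀` outside `I⁺(S)`
    set B : Set ℝ := {t | t ∈ s ∧ t ≤ t₀ ∧ α t ∉ g.chronologicalFuture τ S} with hB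
    have hBne : B.Nonempty := ⟨t₁, ht₁, ht₁t₀, hnot₁⟩
    have hBbdd : BddAbove B := ⟨t₀, fun t ht ↦ ht.2.1⟩
    set T := sSup B with hT
    have ht₁T : t₁ ≤ T := le_csSup hBbdd ⟨ht₁, ht₁t₀, hnot₁⟩
    have hTt₀ : T ≤ t₀ := csSup_le hBne fun t ht ↦ ht.2.1
    have hTs : T ∈ s := hs.out ht₁ ht₀ ⟨ht₁T, hTt₀⟩
    have hcont : ContinuousAt α T := (hα T hTs).1.continuousAt
    -- `α T ∉ I⁺(S)`
    have hTnot : α T ∉ g.chronologicalFuture τ S := by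
      intro hTI
      obtain ⟨ε, hε, hball⟩ := Metric.mem_nhds_iff.1
        (hcont.preimage_mem_nhds ((isOpen_chronologicalFuture_of_boundaryless g τ S).mem_nhds hTI))
      obtain ⟨b, hb, hbT⟩ := exists_lt_of_lt_csSup hBne (show T - ε < T by linarith)
      have hbT' : b ≤ T := le_csSup hBbdd hb
      exact hb.2.2 (hball (by rw [Metric.mem_ball, Real.dist_eq, abs_lt]; constructor <;> linarith))
    have hTlt : T < t₀ := lt_of_le_of_ne hTt₀ fun heq ↦ hTnot (by rw [heq, hαq]; exact hq)
    -- above `T` (up to `t₀`) the curve is in `I⁺(S)`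
    have habove : ∀ u, T < u → u ≤ t₀ → α u ∈ g.chronologicalFuture τ S := by
      intro u hTu hut₀
      by_contra hu
      have hus : u ∈ s := hs.out hTs ht₀ ⟨hTu.le, hut₀⟩
      exact absurd (le_csSup hBbdd ⟨hus, hut₀, hu⟩) (not_le.2 hTu)
    -- shadow points below `α u_k`, `u_k ↓ T`
    set u : ℕ → ℝ := fun k ↦ T + (t₀ - T) / (k + 2) with hu
    have hupos : ∀ k : ℕ, 0 < (t₀ - T) / (k + 2) := fun k ↦
      div_pos (by linarith) (by positivity)
    have huT : ∀ k, T < u k := fun k ↦ by simp only [hu]; linarith [hupos k]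
    have hut₀ : ∀ k, u k ≤ t₀ := fun k ↦ by
      simp only [hu]
      have h2 : (2 : ℝ) ≤ (k : ℝ) + 2 := by linarith [(Nat.cast_nonneg k : (0 : ℝ) ≤ k)]
      have : (t₀ - T) / (k + 2) ≤ (t₀ - T) / 2 :=
        div_le_div_of_nonneg_left (by linarith) (by norm_num) h2
      linarith
    have hutend : Tendsto u atTop (𝓝 T) := by
      have h1 : Tendsto (fun k : ℕ ↦ (t₀ - T) / ((k : ℝ) + 2)) atTop (𝓝 0) := by
        have := tendsto_const_div_atTop_nhds_zero_nat (t₀ - T)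
        have h2 : Tendsto (fun k : ℕ ↦ ((k : ℝ) + 2)) atTop atTop :=
          tendsto_atTop_add_const_right _ _ tendsto_natCast_atTop_atTop
        exact tendsto_const_nhds.div_atTop h2
      simpa [hu] using tendsto_const_nhds.add h1
    have hw : ∀ k, ∃ w ∈ C, α (u k) ∈ g.chronologicalFuture τ {w} := by
      intro k
      have hI := habove (u k) (huT k) (hut₀ k)
      rw [chronologicalFuture_eq_biUnion] at hI
      simp only [mem_iUnion, exists_prop] at hI
      obtain ⟨w, hwS, hwu⟩ := hI
      have hus : u k ∈ s := hs.out hTs ht₀ ⟨(huT k).le, hut₀ k⟩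
      exact ⟨w, hshad (u k) hus (hut₀ k) w hwS hwu, hwu⟩
    choose w hwC hwu using hw
    obtain ⟨w₀, hw₀C, φ, hφ, hwlim⟩ := hC.tendsto_subseq hwC
    have hαlim : Tendsto (fun k ↦ α (u (φ k))) atTop (𝓝 (α T)) :=
      hcont.tendsto.comp (hutend.comp hφ.tendsto_atTop)
    have hTJ : α T ∈ g.causalFuture τ {w₀} :=
      hrel hwlim hαlim fun k ↦ chronologicalFuture_subset_causalFuture g τ _ (hwu (φ k))
    have hTJS : α T ∈ g.causalFuture τ S :=
      causalFuture_mono (singleton_subset_iff.2 (hCS hw₀C)) hTJ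
    rcases hJS hTJS with hTS | hTI
    · exact H T hTs hTt₀ hTS
    · exact hTnot hTI

end Horizon


/-! ### A topological lemma -/

/-- **No corresponding pair over a point of the image.** If `ψ` is injective on the open set `U`
of a regular space and maps open subsets of `U` to open sets, `p ∈ ∂U`, and every pair of
neighbourhoods `V ∋ p`, `V' ∋ ψ y₀` (`y₀ ∈ U`) contains `y ∈ U ∩ V` with `ψ y ∈ V'`, we reach a
contradiction: a closed neighbourhood `B ⊆ U` of `y₀` has `ψ(int B ∩ U)` as a neighbourhood of
`ψ y₀`, the points `y` produced lie in `B` (injectivity), so `p ∈ closure B = B ⊆ U`, while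
`p ∉ U`. [folklore] -/
theorem false_of_mem_image_of_corresponding {α β : Type*} [TopologicalSpace α]
    [TopologicalSpace β] [RegularSpace α] {U : Set α} (hU : IsOpen U) {ψ : α → β}
    (hinj : InjOn ψ U) (hopen : ∀ B : Set α, IsOpen B → IsOpen (ψ '' (B ∩ U))) {p : α}
    (hp : p ∈ frontier U) {y₀ : α} (hy₀ : y₀ ∈ U)
    (hcorr : ∀ V ∈ 𝓝 p, ∀ V' ∈ 𝓝 (ψ y₀), ∃ y ∈ U, y ∈ V ∧ ψ y ∈ V') : False := by
  obtain ⟨B, hBn, hBc, hBU⟩ := exists_mem_nhds_isClosed_subset (hU.mem_nhds hy₀)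
  have hO : ψ '' (interior B ∩ U) ∈ 𝓝 (ψ y₀) :=
    (hopen _ isOpen_interior).mem_nhds ⟨y₀, ⟨mem_interior_iff_mem_nhds.2 hBn, hy₀⟩, rfl⟩
  have hpB : p ∈ closure B := by
    rw [mem_closure_iff_nhds]
    intro V hV
    obtain ⟨y, hyU, hyV, b, ⟨hbB, hbU⟩, hby⟩ := hcorr V hV _ hO
    have hyb : y = b := hinj hyU hbU hby.symm
    exact ⟨y, hyV, hyb ▸ interior_subset hbB⟩
  rw [hBc.closure_eq] at hpB
  have hpU : p ∈ interior U := by rw [hU.interior_eq]; exact hBU hpB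
  exact hp.2 hpU

/-! ### The setting: standing hypotheses as explicit arguments -/

section Core

variable {E₁ : Type*} [NormedAddCommGroup E₁] [NormedSpace ℝ E₁] {H₁ : Type*} [TopologicalSpace H₁]
  {I₁ : ModelWithCorners ℝ E₁ H₁} {n₁ : ℕ∞ω} {M₁ : Type*} [TopologicalSpace M₁] [ChartedSpace H₁ M₁]
  [IsManifold I₁ ∞ M₁] [T2Space M₁] [SecondCountableTopology M₁] [BoundarylessManifold I₁ M₁]
  [FiniteDimensional ℝ E₁] {g₁ : LorentzianMetric I₁ n₁ M₁} {τ₁ : TimeOrientation g₁}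
  {E₂ : Type*} [NormedAddCommGroup E₂] [NormedSpace ℝ E₂] {H₂ : Type*} [TopologicalSpace H₂]
  {I₂ : ModelWithCorners ℝ E₂ H₂} {n₂ : ℕ∞ω} {M₂ : Type*} [TopologicalSpace M₂] [ChartedSpace H₂ M₂]
  [IsManifold I₂ ∞ M₂] [T2Space M₂] [SecondCountableTopology M₂] [BoundarylessManifold I₂ M₂]
  [FiniteDimensional ℝ E₂] {g₂ : LorentzianMetric I₂ n₂ M₂} {τ₂ : TimeOrientation g₂}

omit [T2Space M₁] [SecondCountableTopology M₁] [FiniteDimensional ℝ E₁] in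
/-- **The shadow bound, hypersurface form.** Let `(p, p')` correspond, `p ≪ p⁺`, `S` achronal and
a Cauchy hypersurface of the open `W ⊆ M₂`, `ψ(S₁) = S`, `ψ(U) ⊆ W`. Then
`I⁻(p') ∩ S ⊆ ψ(J⁻(p⁺) ∩ S₁)`: for `z ∈ I⁻(p') ∩ S`, some `y ∈ U ∩ I⁻(p⁺)` near `p` has
`z ≪ ψ y`; the timelike segment from `z ∈ S` to `ψ y ∈ W` lies in `W` (no timelike entry into `W`
from `J⁺(S)`, `IsAchronal.mem_opens_of_mem_chronologicalFuture`), so it pulls back along `ψ` to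
`s ≪ y ≪ p⁺` with `ψ s = z`. Compare `chronologicalPast_inter_subset_image_of_corresponding`
(sub-datum case). [cite: Sbierski2016AHP, §3.2, proof of Prop. 13 (arXiv numbering)] -/
theorem chronologicalPast_inter_subset_image_of_corresponding_hyp (hn₂ : 2 ≤ n₂)
    (hres₂ : PseudoRiemannianMetric.contMDiff_restrict (I := I₂) (n := n₂) (M := M₂))
    (hτ₂ : τ₂.contMDiff_restrict) {S₁ : Set M₁} {U : Opens M₁} (hS₁U : S₁ ⊆ U)
    {S : Set M₂} (hA : g₂.IsAchronal τ₂ S) {W : Opens M₂}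
    (hW : (g₂.restrict hres₂ W).IsCauchyHypersurface (τ₂.restrict hres₂ hτ₂ W) (Subtype.val ⁻¹' S))
    {ψ : M₁ → M₂} (hψW : MapsTo ψ U W) (hψS : ψ '' S₁ = S)
    (hpull : ∀ ⦃γ : ℝ → M₂⦄ ⦃a b : ℝ⦄, a < b → g₂.IsFutureTimelikeCurveOn τ₂ γ (Icc a b) →
      (∀ t ∈ Icc a b, γ t ∈ W) → ∀ ⦃x y : M₁⦄, x ∈ U → y ∈ U → γ a = ψ x → γ b = ψ y →
      y ∈ g₁.chronologicalFuture τ₁ {x})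
    {p pf : M₁} (hpp : pf ∈ g₁.chronologicalFuture τ₁ {p}) {p' : M₂}
    (hcorr : ∀ V ∈ 𝓝 p, ∀ V' ∈ 𝓝 p', ∃ y ∈ (U : Set M₁), y ∈ V ∧ ψ y ∈ V') :
    g₂.chronologicalPast τ₂ {p'} ∩ S ⊆ ψ '' (g₁.causalPast τ₁ {pf} ∩ S₁) := by
  rintro z ⟨hzp', hzS⟩
  have hp'z : p' ∈ g₂.chronologicalFuture τ₂ {z} := mem_chronologicalFuture_of_mem_chronologicalPast hzp'
  -- a point `y ∈ U`, `y ≪ p⁺`, with `z ≪ ψ y`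
  obtain ⟨y, hyU, hyp, hzy⟩ := hcorr _
    ((isOpen_chronologicalPast_of_boundaryless g₁ τ₁ {pf}).mem_nhds
      (mem_chronologicalPast_of_mem_chronologicalFuture hpp)) _
    ((isOpen_chronologicalFuture_of_boundaryless g₂ τ₂ {z}).mem_nhds hp'z)
  -- `z = ψ s` with `s ∈ S₁`
  have hzS' := hzS
  rw [← hψS] at hzS'
  obtain ⟨s, hsS, rfl⟩ := hzS'
  refine ⟨s, ⟨?_, hsS⟩, rfl⟩
  -- the segment from `ψ s` to `ψ y` stays in `W` (no timelike entry) and pulls back: `s ≪ y ≪ p⁺`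
  obtain ⟨z', hz', γ, a, b, hab, hγ, hγa, hγb⟩ := hzy
  rw [mem_singleton_iff] at hz'
  subst hz'
  have hγW : ∀ t ∈ Icc a b, γ t ∈ W := by
    intro t ht
    rcases eq_or_lt_of_le ht.1 with heq | hat
    · rw [← heq, hγa]; exact hψW (hS₁U hsS)
    rcases eq_or_lt_of_le ht.2 with heq | htb
    · rw [heq, hγb]; exact hψW hyU
    -- `ψ s ≪ γ t ≪ ψ y ∈ W` with `γ t ∈ I⁺(S) ⊆ J⁺(S)`
    have h1 : γ t ∈ g₂.chronologicalFuture τ₂ {γ a} :=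
      ⟨γ a, rfl, γ, a, t, hat, hγ.mono (Icc_subset_Icc le_rfl ht.2), rfl, rfl⟩
    have h2 : γ b ∈ g₂.chronologicalFuture τ₂ {γ t} :=
      ⟨γ t, rfl, γ, t, b, htb, hγ.mono (Icc_subset_Icc ht.1 le_rfl), rfl, rfl⟩
    have hJ : γ t ∈ g₂.causalFuture τ₂ S :=
      causalFuture_mono (singleton_subset_iff.2 (by rw [hγa]; exact hzS))
        (chronologicalFuture_subset_causalFuture g₂ τ₂ _ h1)
    exact hA.mem_opens_of_mem_chronologicalFuture hn₂ hres₂ hτ₂ hW hJ (by rw [hγb]; exact hψW hyU) h2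
  have hsy : y ∈ g₁.chronologicalFuture τ₁ {s} := hpull hab hγ hγW (hS₁U hsS) hyU hγa hγb
  have hsp : pf ∈ g₁.chronologicalFuture τ₁ {s} :=
    mem_chronologicalFuture_trans hsy (mem_chronologicalFuture_of_mem_chronologicalPast hyp)
  exact chronologicalFuture_subset_causalFuture g₁ τ₁.reverse {pf}
    (mem_chronologicalPast_of_mem_chronologicalFuture hsp)

/-- **Future case: no corresponding pair with `p ∈ ∂U ∩ I⁺(S₁)`.** See the module docstring.
The displayed inputs: global hyperbolicity of `M₁` (`hK₁`) and `M₂` (`hrel₂`, `hKC₂`, `himp₂`),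
`J⁺(S) ⊆ S ∪ I⁺(S)` (`hJS`), and (hD⁺) `W ⊇ D⁺(S) ∩ I⁺(S)` (`hD`).
[cite: HawkingEllis1973CUP, §7.6, pp. 249–251] [cite: Sbierski2016AHP, §3.2, Prop. 13 (arXiv numbering)] -/
theorem false_of_corresponding_future (hn₁ : 2 ≤ n₁) (hn₂ : 2 ≤ n₂)
    (hres₁ : PseudoRiemannianMetric.contMDiff_restrict (I := I₁) (n := n₁) (M := M₁))
    (hτ₁ : τ₁.contMDiff_restrict)
    (hres₂ : PseudoRiemannianMetric.contMDiff_restrict (I := I₂) (n := n₂) (M := M₂))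
    (hτ₂ : τ₂.contMDiff_restrict)
    {S₁ : Set M₁} (hS₁ : g₁.IsCauchyHypersurface τ₁ S₁) {U : Opens M₁} (hS₁U : S₁ ⊆ U)
    (hU : (g₁.restrict hres₁ U).IsCauchyHypersurface (τ₁.restrict hres₁ hτ₁ U) (Subtype.val ⁻¹' S₁))
    {S : Set M₂} (hA : g₂.IsAchronal τ₂ S) {W : Opens M₂}
    (hW : (g₂.restrict hres₂ W).IsCauchyHypersurface (τ₂.restrict hres₂ hτ₂ W) (Subtype.val ⁻¹' S))
    {ψ : M₁ → M₂} (hψW : MapsTo ψ U W) (hWψ : (W : Set M₂) ⊆ ψ '' U) (hψc : ContinuousOn ψ U)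
    (hinj : InjOn ψ U) (hopen : ∀ B : Set M₁, IsOpen B → IsOpen (ψ '' (B ∩ U)))
    (hψS : ψ '' S₁ = S)
    (hpush : ∀ ⦃γ : ℝ → M₁⦄ ⦃a b : ℝ⦄, a < b → g₁.IsFutureTimelikeCurveOn τ₁ γ (Icc a b) →
      (∀ t ∈ Icc a b, γ t ∈ U) → ψ (γ b) ∈ g₂.chronologicalFuture τ₂ {ψ (γ a)})
    (hpull : ∀ ⦃γ : ℝ → M₂⦄ ⦃a b : ℝ⦄, a < b → g₂.IsFutureTimelikeCurveOn τ₂ γ (Icc a b) →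
      (∀ t ∈ Icc a b, γ t ∈ W) → ∀ ⦃x y : M₁⦄, x ∈ U → y ∈ U → γ a = ψ x → γ b = ψ y →
      y ∈ g₁.chronologicalFuture τ₁ {x})
    (hK₁ : ∀ x : M₁, IsCompact (g₁.causalPast τ₁ {x} ∩ g₁.causalFuture τ₁ S₁))
    (hrel₂ : ∀ {xs ys : ℕ → M₂} {x y : M₂}, Tendsto xs atTop (𝓝 x) → Tendsto ys atTop (𝓝 y) →
      (∀ j, ys j ∈ g₂.causalFuture τ₂ {xs j}) → y ∈ g₂.causalFuture τ₂ {x})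
    (hKC₂ : ∀ C : Set M₂, IsCompact C → ∀ x : M₂,
      IsCompact (g₂.causalFuture τ₂ C ∩ g₂.causalPast τ₂ {x}))
    (himp₂ : ∀ K : Set M₂, IsCompact K → ∀ (γ : ℝ → M₂) (s : Set ℝ), s.OrdConnected →
      g₂.IsFutureCausalCurveOn τ₂ γ s → IsPastEndless γ s → ∀ t₀ ∈ s, ∃ t ∈ s, t ≤ t₀ ∧ γ t ∉ K)
    (hJS : g₂.causalFuture τ₂ S ⊆ S ∪ g₂.chronologicalFuture τ₂ S)
    (hD : ∀ q ∈ g₂.chronologicalFuture τ₂ S,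
      (∀ (α : ℝ → M₂) (s : Set ℝ), s.OrdConnected → g₂.IsFutureCausalCurveOn τ₂ α s →
        IsPastEndless α s → ∀ t₀ ∈ s, α t₀ = q → ∃ t ∈ s, t ≤ t₀ ∧ α t ∈ S) → q ∈ W)
    {p : M₁} (hp : p ∈ frontier (U : Set M₁)) (hpI : p ∈ g₁.chronologicalFuture τ₁ S₁) {p' : M₂}
    (hcorr : ∀ V ∈ 𝓝 p, ∀ V' ∈ 𝓝 p', ∃ y ∈ (U : Set M₁), y ∈ V ∧ ψ y ∈ V') : False := by
  haveI : LocallyCompactSpace M₁ := Manifold.locallyCompact_of_finiteDimensional (M := M₁) I₁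
  have hn2' : (1 : ℕ∞ω) ≤ n₂ := le_trans one_le_two hn₂
  have hSW : S ⊆ W := by
    rw [← hψS]
    rintro _ ⟨s, hs, rfl⟩
    exact hψW (hS₁U hs)
  -- points below `p` and `p' ∈ I⁺(S)`
  obtain ⟨r, r₁, hrU, hr₁U, hrI, hrr₁, hpr₁⟩ := exists_mem_opens_ll_ll hn₁ hres₁ hτ₁ hS₁ hU hp hpI
  have hle : p' ∈ g₂.causalFuture τ₂ {ψ r₁} :=
    mem_causalFuture_glue_of_corresponding hn₁ hres₁ hτ₁ hS₁ hU hpush hrel₂ hcorr hr₁U hpr₁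
  have hll : ψ r₁ ∈ g₂.chronologicalFuture τ₂ {ψ r} :=
    glue_mem_chronologicalFuture_of_mem hn₁ hres₁ hτ₁ hS₁ hU hpush hrU hr₁U hrr₁
  have h1 : p' ∈ g₂.chronologicalFuture τ₂ {ψ r} :=
    mem_chronologicalFuture_of_mem_chronologicalFuture_of_mem_causalFuture hn2' hll hle
  have h2 : ψ r ∈ g₂.chronologicalFuture τ₂ S := by
    have h := hrI
    rw [chronologicalFuture_eq_biUnion] at h
    simp only [mem_iUnion, exists_prop] at h
    obtain ⟨s, hsS, hrs⟩ := h
    have hψs : ψ s ∈ S := by rw [← hψS]; exact mem_image_of_mem ψ hsS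
    have h3 : ψ r ∈ g₂.chronologicalFuture τ₂ {ψ s} :=
      glue_mem_chronologicalFuture_of_mem hn₁ hres₁ hτ₁ hS₁ hU hpush (hS₁U hsS) hrU hrs
    exact chronologicalFuture_mono (singleton_subset_iff.2 hψs) h3
  have h3 : p' ∈ g₂.chronologicalFuture τ₂ S := mem_chronologicalFuture_trans h2 h1
  -- the compact shadow
  obtain ⟨pf, hpf⟩ := exists_mem_chronologicalFuture_singleton (g := g₁) (τ := τ₁) hn₁ p
  set C : Set M₂ := ψ '' (g₁.causalPast τ₁ {pf} ∩ S₁) with hC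
  have hCc : IsCompact C := isCompact_image_causalPast_inter hn₁ hS₁ hS₁U hK₁ hψc pf
  have hCS : C ⊆ S := by
    rintro _ ⟨s, hs, rfl⟩
    rw [← hψS]
    exact mem_image_of_mem ψ hs.2
  have hshadow : g₂.chronologicalPast τ₂ {p'} ∩ S ⊆ C :=
    chronologicalPast_inter_subset_image_of_corresponding_hyp hn₂ hres₂ hτ₂ hS₁U hA hW hψW hψS
      hpull hpf hcorr
  -- the horizon lemma: `p' ∈ D⁺(S)`, hence `p' ∈ W` by (hD)
  have hmeet : ∀ (α : ℝ → M₂) (s : Set ℝ), s.OrdConnected → g₂.IsFutureCausalCurveOn τ₂ α s →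
      IsPastEndless α s → ∀ t₀ ∈ s, α t₀ = p' → ∃ t ∈ s, t ≤ t₀ ∧ α t ∈ S :=
    fun α s hs hα hend t₀ ht₀ hαq ↦
      exists_mem_of_isPastEndless_of_shadow_subset hn2' hCS hCc hJS hrel₂ (hKC₂ C hCc) himp₂ h3
        hshadow hs hα hend ht₀ hαq
  have hp'W : p' ∈ W := hD p' h3 hmeet
  obtain ⟨y₀, hy₀U, hy₀⟩ := hWψ hp'W
  refine false_of_mem_image_of_corresponding U.2 hinj hopen hp hy₀U ?_
  rw [hy₀]
  exact fun V hV V' hV' ↦ hcorr V hV V' hV'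

/-- **Past case: no corresponding pair with `p ∈ ∂U ∩ I⁻(S₁)`** — the future case for the
reversed time orientations `-τ₁`, `-τ₂`: Cauchy hypersurfaces, achronality, the transport
hypotheses and the closedness of `≤` are self-dual; `I±`, `J±`, past/future endlessness and the
two halves of (hD) are exchanged, so the displayed inputs enter in the dual form (`hK₁'`, `hKC₂'`,
`himp₂'`, `hJS'`, `hD'`). O'Neill 1983, Ch. 14, p. 402 (time duality).
[cite: HawkingEllis1973CUP, §7.6, pp. 249–251] [cite: ONeillSemiRiemannian1983, Ch. 14, p. 402] -/
theorem false_of_corresponding_past (hn₁ : 2 ≤ n₁) (hn₂ : 2 ≤ n₂)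
    (hres₁ : PseudoRiemannianMetric.contMDiff_restrict (I := I₁) (n := n₁) (M := M₁))
    (hτ₁ : τ₁.contMDiff_restrict)
    (hres₂ : PseudoRiemannianMetric.contMDiff_restrict (I := I₂) (n := n₂) (M := M₂))
    (hτ₂ : τ₂.contMDiff_restrict)
    {S₁ : Set M₁} (hS₁ : g₁.IsCauchyHypersurface τ₁ S₁) {U : Opens M₁} (hS₁U : S₁ ⊆ U)
    (hU : (g₁.restrict hres₁ U).IsCauchyHypersurface (τ₁.restrict hres₁ hτ₁ U) (Subtype.val ⁻¹' S₁))
    {S : Set M₂} (hA : g₂.IsAchronal τ₂ S) {W : Opens M₂}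
    (hW : (g₂.restrict hres₂ W).IsCauchyHypersurface (τ₂.restrict hres₂ hτ₂ W) (Subtype.val ⁻¹' S))
    {ψ : M₁ → M₂} (hψW : MapsTo ψ U W) (hWψ : (W : Set M₂) ⊆ ψ '' U) (hψc : ContinuousOn ψ U)
    (hinj : InjOn ψ U) (hopen : ∀ B : Set M₁, IsOpen B → IsOpen (ψ '' (B ∩ U)))
    (hψS : ψ '' S₁ = S)
    (hpush : ∀ ⦃γ : ℝ → M₁⦄ ⦃a b : ℝ⦄, a < b → g₁.IsFutureTimelikeCurveOn τ₁ γ (Icc a b) →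
      (∀ t ∈ Icc a b, γ t ∈ U) → ψ (γ b) ∈ g₂.chronologicalFuture τ₂ {ψ (γ a)})
    (hpull : ∀ ⦃γ : ℝ → M₂⦄ ⦃a b : ℝ⦄, a < b → g₂.IsFutureTimelikeCurveOn τ₂ γ (Icc a b) →
      (∀ t ∈ Icc a b, γ t ∈ W) → ∀ ⦃x y : M₁⦄, x ∈ U → y ∈ U → γ a = ψ x → γ b = ψ y →
      y ∈ g₁.chronologicalFuture τ₁ {x})
    (hK₁' : ∀ x : M₁, IsCompact (g₁.causalFuture τ₁ {x} ∩ g₁.causalPast τ₁ S₁))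
    (hrel₂ : ∀ {xs ys : ℕ → M₂} {x y : M₂}, Tendsto xs atTop (𝓝 x) → Tendsto ys atTop (𝓝 y) →
      (∀ j, ys j ∈ g₂.causalFuture τ₂ {xs j}) → y ∈ g₂.causalFuture τ₂ {x})
    (hKC₂' : ∀ C : Set M₂, IsCompact C → ∀ x : M₂,
      IsCompact (g₂.causalPast τ₂ C ∩ g₂.causalFuture τ₂ {x}))
    (himp₂' : ∀ K : Set M₂, IsCompact K → ∀ (γ : ℝ → M₂) (s : Set ℝ), s.OrdConnected →
      g₂.IsFutureCausalCurveOn τ₂ γ s → IsFutureEndless γ s → ∀ t₀ ∈ s, ∃ t ∈ s, t₀ ≤ t ∧ γ t ∉ K)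
    (hJS' : g₂.causalPast τ₂ S ⊆ S ∪ g₂.chronologicalPast τ₂ S)
    (hD' : ∀ q ∈ g₂.chronologicalPast τ₂ S,
      (∀ (α : ℝ → M₂) (s : Set ℝ), s.OrdConnected → g₂.IsFutureCausalCurveOn τ₂ α s →
        IsFutureEndless α s → ∀ t₀ ∈ s, α t₀ = q → ∃ t ∈ s, t₀ ≤ t ∧ α t ∈ S) → q ∈ W)
    {p : M₁} (hp : p ∈ frontier (U : Set M₁)) (hpI : p ∈ g₁.chronologicalPast τ₁ S₁) {p' : M₂}
    (hcorr : ∀ V ∈ 𝓝 p, ∀ V' ∈ 𝓝 p', ∃ y ∈ (U : Set M₁), y ∈ V ∧ ψ y ∈ V') : False := by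
  have hτ₁' : τ₁.reverse.contMDiff_restrict := τ₁.contMDiff_restrict_reverse hτ₁
  have hτ₂' : τ₂.reverse.contMDiff_restrict := τ₂.contMDiff_restrict_reverse hτ₂
  have hU' : (g₁.restrict hres₁ U).IsCauchyHypersurface (τ₁.reverse.restrict hres₁ hτ₁' U)
      (Subtype.val ⁻¹' S₁) := by
    rw [← TimeOrientation.restrict_reverse]
    exact hU.reverse
  have hW' : (g₂.restrict hres₂ W).IsCauchyHypersurface (τ₂.reverse.restrict hres₂ hτ₂' W)
      (Subtype.val ⁻¹' S) := by
    rw [← TimeOrientation.restrict_reverse]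
    exact hW.reverse
  -- the transport hypotheses for the reversed orientations (reverse the parameter)
  have hpush' : ∀ ⦃γ : ℝ → M₁⦄ ⦃a b : ℝ⦄, a < b → g₁.IsFutureTimelikeCurveOn τ₁.reverse γ (Icc a b) →
      (∀ t ∈ Icc a b, γ t ∈ U) →
      ψ (γ b) ∈ g₂.chronologicalFuture τ₂.reverse {ψ (γ a)} := by
    intro γ a b hab hγ hγU
    have hγ' : g₁.IsFutureTimelikeCurveOn τ₁ (fun t ↦ γ (a + b - t)) (Icc a b) :=
      isFutureTimelikeCurveOn_reverse_reverse_iff.1 hγ.reverseParam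
    have hγU' : ∀ t ∈ Icc a b, γ (a + b - t) ∈ U := fun t ht ↦
      hγU (a + b - t) ⟨by linarith [ht.2], by linarith [ht.1]⟩
    have h := hpush hab hγ' hγU'
    have h' : ψ (γ (a + b - b)) ∈ g₂.chronologicalFuture τ₂ {ψ (γ (a + b - a))} := h
    rw [add_sub_cancel_right, add_sub_cancel_left] at h'
    exact mem_chronologicalPast_of_mem_chronologicalFuture h'
  have hpull' : ∀ ⦃γ : ℝ → M₂⦄ ⦃a b : ℝ⦄, a < b → g₂.IsFutureTimelikeCurveOn τ₂.reverse γ (Icc a b) →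
      (∀ t ∈ Icc a b, γ t ∈ W) → ∀ ⦃x y : M₁⦄, x ∈ U → y ∈ U → γ a = ψ x → γ b = ψ y →
      y ∈ g₁.chronologicalFuture τ₁.reverse {x} := by
    intro γ a b hab hγ hγW x y hx hy hγa hγb
    have hγ' : g₂.IsFutureTimelikeCurveOn τ₂ (fun t ↦ γ (a + b - t)) (Icc a b) :=
      isFutureTimelikeCurveOn_reverse_reverse_iff.1 hγ.reverseParam
    have hγW' : ∀ t ∈ Icc a b, γ (a + b - t) ∈ W := fun t ht ↦
      hγW (a + b - t) ⟨by linarith [ht.2], by linarith [ht.1]⟩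
    have h := hpull hab hγ' hγW' hy hx (by show γ (a + b - a) = ψ y; rw [add_sub_cancel_left]; exact hγb)
      (by show γ (a + b - b) = ψ x; rw [add_sub_cancel_right]; exact hγa)
    exact mem_chronologicalPast_of_mem_chronologicalFuture h
  have hK₁'' : ∀ x : M₁, IsCompact (g₁.causalPast τ₁.reverse {x} ∩ g₁.causalFuture τ₁.reverse S₁) :=
    fun x ↦ by rw [causalPast_reverse]; exact hK₁' x
  have hrel₂' : ∀ {xs ys : ℕ → M₂} {x y : M₂}, Tendsto xs atTop (𝓝 x) → Tendsto ys atTop (𝓝 y) →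
      (∀ j, ys j ∈ g₂.causalFuture τ₂.reverse {xs j}) → y ∈ g₂.causalFuture τ₂.reverse {x} := by
    intro xs ys x y hx hy h
    show y ∈ g₂.causalPast τ₂ {x}
    exact mem_causalPast_singleton_iff.2 (hrel₂ hy hx fun j ↦ mem_causalPast_singleton_iff.1 (h j))
  have hKC₂'' : ∀ C : Set M₂, IsCompact C → ∀ x : M₂,
      IsCompact (g₂.causalFuture τ₂.reverse C ∩ g₂.causalPast τ₂.reverse {x}) := by
    intro C hC x
    rw [causalPast_reverse]
    exact hKC₂' C hC x
  have himp₂'' : ∀ K : Set M₂, IsCompact K → ∀ (γ : ℝ → M₂) (s : Set ℝ), s.OrdConnected →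
      g₂.IsFutureCausalCurveOn τ₂.reverse γ s → IsPastEndless γ s → ∀ t₀ ∈ s,
      ∃ t ∈ s, t ≤ t₀ ∧ γ t ∉ K := by
    intro K hK γ s hs hγ hend t₀ ht₀
    have hγ' : g₂.IsFutureCausalCurveOn τ₂ (fun t ↦ γ (-t)) (Neg.neg ⁻¹' s) :=
      isFutureCausalCurveOn_reverse_reverse_iff.1 hγ.comp_neg
    have hend' : IsFutureEndless (fun t ↦ γ (-t)) (Neg.neg ⁻¹' s) :=
      isFutureEndless_comp_neg_iff.2 hend
    obtain ⟨t, ht, ht₀t, htK⟩ := himp₂' K hK _ _ (ordConnected_preimage_neg hs) hγ' hend' (-t₀)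
      (show -(-t₀) ∈ s by rw [neg_neg]; exact ht₀)
    exact ⟨-t, ht, by linarith, htK⟩
  have hJS'' : g₂.causalFuture τ₂.reverse S ⊆ S ∪ g₂.chronologicalFuture τ₂.reverse S := hJS'
  have hD'' : ∀ q ∈ g₂.chronologicalFuture τ₂.reverse S,
      (∀ (α : ℝ → M₂) (s : Set ℝ), s.OrdConnected → g₂.IsFutureCausalCurveOn τ₂.reverse α s →
        IsPastEndless α s → ∀ t₀ ∈ s, α t₀ = q → ∃ t ∈ s, t ≤ t₀ ∧ α t ∈ S) → q ∈ W := by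
    intro q hq H
    refine hD' q hq fun β s hs hβ hend t₀ ht₀ hβq ↦ ?_
    have hβ' : g₂.IsFutureCausalCurveOn τ₂.reverse (fun t ↦ β (-t)) (Neg.neg ⁻¹' s) := hβ.comp_neg
    have hend' : IsPastEndless (fun t ↦ β (-t)) (Neg.neg ⁻¹' s) := isPastEndless_comp_neg_iff.2 hend
    obtain ⟨t, ht, htt₀, htS⟩ := H _ _ (ordConnected_preimage_neg hs) hβ' hend' (-t₀)
      (show -(-t₀) ∈ s by rw [neg_neg]; exact ht₀) (by show β (-(-t₀)) = q; rw [neg_neg]; exact hβq)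
    exact ⟨-t, ht, by linarith, htS⟩
  exact false_of_corresponding_future (τ₁ := τ₁.reverse) (τ₂ := τ₂.reverse) hn₁ hn₂ hres₁ hτ₁'
    hres₂ hτ₂' hS₁.reverse hS₁U hU' hA.reverse hW' hψW hWψ hψc hinj hopen hψS hpush' hpull' hK₁''
    hrel₂' hKC₂'' himp₂'' hJS'' hD'' hp hpI hcorr

/-- **Theorem: no corresponding boundary points.** For any `p ∈ ∂U` — which lies in `I⁺(S₁)` or
in `I⁻(S₁)`, as `S₁ ⊆ U` and `M₁ = I⁻(S₁) ⊔ S₁ ⊔ I⁺(S₁)` — and any `p' ∈ M₂`, the pair `(p, p')`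
does not correspond. The global-hyperbolicity inputs, the horismos conditions `J±(S) ⊆ S ∪ I±(S)`
and the domain-of-dependence conditions (hD±) on `W` are displayed in both time directions.
[cite: HawkingEllis1973CUP, §7.6, pp. 249–251] [cite: Sbierski2016AHP, §3.2, Def. 11 and Prop. 13 (arXiv numbering)] -/
theorem false_of_corresponding (hn₁ : 2 ≤ n₁) (hn₂ : 2 ≤ n₂)
    (hres₁ : PseudoRiemannianMetric.contMDiff_restrict (I := I₁) (n := n₁) (M := M₁))
    (hτ₁ : τ₁.contMDiff_restrict)
    (hres₂ : PseudoRiemannianMetric.contMDiff_restrict (I := I₂) (n := n₂) (M := M₂))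
    (hτ₂ : τ₂.contMDiff_restrict)
    {S₁ : Set M₁} (hS₁ : g₁.IsCauchyHypersurface τ₁ S₁) {U : Opens M₁} (hS₁U : S₁ ⊆ U)
    (hU : (g₁.restrict hres₁ U).IsCauchyHypersurface (τ₁.restrict hres₁ hτ₁ U) (Subtype.val ⁻¹' S₁))
    {S : Set M₂} (hA : g₂.IsAchronal τ₂ S) {W : Opens M₂}
    (hW : (g₂.restrict hres₂ W).IsCauchyHypersurface (τ₂.restrict hres₂ hτ₂ W) (Subtype.val ⁻¹' S))
    {ψ : M₁ → M₂} (hψW : MapsTo ψ U W) (hWψ : (W : Set M₂) ⊆ ψ '' U) (hψc : ContinuousOn ψ U)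
    (hinj : InjOn ψ U) (hopen : ∀ B : Set M₁, IsOpen B → IsOpen (ψ '' (B ∩ U)))
    (hψS : ψ '' S₁ = S)
    (hpush : ∀ ⦃γ : ℝ → M₁⦄ ⦃a b : ℝ⦄, a < b → g₁.IsFutureTimelikeCurveOn τ₁ γ (Icc a b) →
      (∀ t ∈ Icc a b, γ t ∈ U) → ψ (γ b) ∈ g₂.chronologicalFuture τ₂ {ψ (γ a)})
    (hpull : ∀ ⦃γ : ℝ → M₂⦄ ⦃a b : ℝ⦄, a < b → g₂.IsFutureTimelikeCurveOn τ₂ γ (Icc a b) →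
      (∀ t ∈ Icc a b, γ t ∈ W) → ∀ ⦃x y : M₁⦄, x ∈ U → y ∈ U → γ a = ψ x → γ b = ψ y →
      y ∈ g₁.chronologicalFuture τ₁ {x})
    (hK₁ : ∀ x : M₁, IsCompact (g₁.causalPast τ₁ {x} ∩ g₁.causalFuture τ₁ S₁))
    (hK₁' : ∀ x : M₁, IsCompact (g₁.causalFuture τ₁ {x} ∩ g₁.causalPast τ₁ S₁))
    (hrel₂ : ∀ {xs ys : ℕ → M₂} {x y : M₂}, Tendsto xs atTop (𝓝 x) → Tendsto ys atTop (𝓝 y) →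
      (∀ j, ys j ∈ g₂.causalFuture τ₂ {xs j}) → y ∈ g₂.causalFuture τ₂ {x})
    (hKC₂ : ∀ C : Set M₂, IsCompact C → ∀ x : M₂,
      IsCompact (g₂.causalFuture τ₂ C ∩ g₂.causalPast τ₂ {x}))
    (hKC₂' : ∀ C : Set M₂, IsCompact C → ∀ x : M₂,
      IsCompact (g₂.causalPast τ₂ C ∩ g₂.causalFuture τ₂ {x}))
    (himp₂ : ∀ K : Set M₂, IsCompact K → ∀ (γ : ℝ → M₂) (s : Set ℝ), s.OrdConnected →
      g₂.IsFutureCausalCurveOn τ₂ γ s → IsPastEndless γ s → ∀ t₀ ∈ s, ∃ t ∈ s, t ≤ t₀ ∧ γ t ∉ K)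
    (himp₂' : ∀ K : Set M₂, IsCompact K → ∀ (γ : ℝ → M₂) (s : Set ℝ), s.OrdConnected →
      g₂.IsFutureCausalCurveOn τ₂ γ s → IsFutureEndless γ s → ∀ t₀ ∈ s, ∃ t ∈ s, t₀ ≤ t ∧ γ t ∉ K)
    (hJS : g₂.causalFuture τ₂ S ⊆ S ∪ g₂.chronologicalFuture τ₂ S)
    (hJS' : g₂.causalPast τ₂ S ⊆ S ∪ g₂.chronologicalPast τ₂ S)
    (hD : ∀ q ∈ g₂.chronologicalFuture τ₂ S,
      (∀ (α : ℝ → M₂) (s : Set ℝ), s.OrdConnected → g₂.IsFutureCausalCurveOn τ₂ α s →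
        IsPastEndless α s → ∀ t₀ ∈ s, α t₀ = q → ∃ t ∈ s, t ≤ t₀ ∧ α t ∈ S) → q ∈ W)
    (hD' : ∀ q ∈ g₂.chronologicalPast τ₂ S,
      (∀ (α : ℝ → M₂) (s : Set ℝ), s.OrdConnected → g₂.IsFutureCausalCurveOn τ₂ α s →
        IsFutureEndless α s → ∀ t₀ ∈ s, α t₀ = q → ∃ t ∈ s, t₀ ≤ t ∧ α t ∈ S) → q ∈ W)
    {p : M₁} (hp : p ∈ frontier (U : Set M₁)) {p' : M₂}
    (hcorr : ∀ V ∈ 𝓝 p, ∀ V' ∈ 𝓝 p', ∃ y ∈ (U : Set M₁), y ∈ V ∧ ψ y ∈ V') : False := by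
  -- `p ∉ U ⊇ S₁`, so `p ∈ I⁺(S₁) ∪ I⁻(S₁)`
  have hpU : p ∉ (U : Set M₁) := fun h ↦ hp.2 (by rw [U.isOpen.interior_eq]; exact h)
  have hpS : p ∉ S₁ := fun h ↦ hpU (hS₁U h)
  rcases hS₁.mem_chronologicalFuture_union_chronologicalPast hn₁ hpS with hpI | hpI
  · exact false_of_corresponding_future hn₁ hn₂ hres₁ hτ₁ hres₂ hτ₂ hS₁ hS₁U hU hA hW hψW hWψ hψc
      hinj hopen hψS hpush hpull hK₁ hrel₂ hKC₂ himp₂ hJS hD hp hpI hcorr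
  · exact false_of_corresponding_past hn₁ hn₂ hres₁ hτ₁ hres₂ hτ₂ hS₁ hS₁U hU hA hW hψW hWψ hψc
      hinj hopen hψS hpush hpull hK₁' hrel₂ hKC₂' himp₂' hJS' hD' hp hpI hcorr

end Core

end LorentzianMetric

/-! ### The displayed inputs for Cauchy developments and Cauchy neighbourhoods -/

namespace LorentzianMetric

variable {E : Type*} [NormedAddCommGroup E] [NormedSpace ℝ E] {H : Type*} [TopologicalSpace H]
  {I : ModelWithCorners ℝ E H} {n : ℕ∞ω} {M : Type*} [TopologicalSpace M] [ChartedSpace H M]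
  [IsManifold I ∞ M] [T2Space M] [SecondCountableTopology M] [BoundarylessManifold I M]
  [FiniteDimensional ℝ E] {g : LorentzianMetric I n M} {τ : TimeOrientation g}

omit [T2Space M] [SecondCountableTopology M] [BoundarylessManifold I M] [FiniteDimensional ℝ E] in
/-- **Strong causality is invariant under time reversal** (the defining condition is symmetric
under reversing the parameter of the causal segments). O'Neill 1983, Ch. 14, p. 402.
[cite: ONeillSemiRiemannian1983, Ch. 14, p. 402 (time duality)] -/
theorem IsStronglyCausal.reverse (h : g.IsStronglyCausal τ) : g.IsStronglyCausal τ.reverse := by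
  intro p U hU
  obtain ⟨V, hV, hVU, hbox⟩ := h p U hU
  refine ⟨V, hV, hVU, fun γ a b hab hγ ha hb t ht ↦ ?_⟩
  have hγ' : g.IsFutureCausalCurveOn τ (fun s ↦ γ (a + b - s)) (Icc a b) :=
    isFutureCausalCurveOn_reverse_reverse_iff.1 hγ.reverseParam
  have h' := hbox _ a b hab hγ' (by show γ (a + b - a) ∈ V; rw [add_sub_cancel_left]; exact hb)
    (by show γ (a + b - b) ∈ V; rw [add_sub_cancel_right]; exact ha) (a + b - t)
    ⟨by linarith [ht.2], by linarith [ht.1]⟩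
  have heq : a + b - (a + b - t) = t := by ring
  rwa [heq] at h'

end LorentzianMetric

/-! ### Global hyperbolicity of Cauchy developments in the forms used -/

section Developments

universe u

variable {n : ℕ} {X : Type u} [TopologicalSpace X] [ChartedSpace (EuclideanSpace ℝ (Fin n)) X]
  [IsManifold (𝓡 n) ∞ X] [ConnectedSpace X] {D : InitialDataSet (𝓡 n) X}

namespace CauchyDevelopment

/-- **`J⁺(C) ∩ J⁻(x)` is compact for compact `C`** in a Cauchy development (Hawking–Ellis 1973,
Prop. 6.6.6 / O'Neill 1983, Lemma 14.40, for compact sets): cover `C` by finitely many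
`I⁺(cᵢ⁻)`, `cᵢ⁻ ≪ cᵢ`; then `J⁺(C) ∩ J⁻(x)` is a closed subset
(`IsGloballyHyperbolic.isClosed_causalFuture_of_isCompact`, `isClosed_causalPast_singleton`) of the
finite union of the compact causal diamonds `J⁺(cᵢ⁻) ∩ J⁻(x)`.
[cite: HawkingEllis1973CUP, §6.6, Prop. 6.6.6] -/
theorem isCompact_causalFuture_inter_causalPast_of_isCompact (𝒟 : CauchyDevelopment D)
    {C : Set 𝒟.carrier} (hC : IsCompact C) (x : 𝒟.carrier) :
    IsCompact (𝒟.metric.causalFuture 𝒟.timeOrientation C ∩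
      𝒟.metric.causalPast 𝒟.timeOrientation {x}) := by
  classical
  have hn2 : (2 : ℕ∞ω) ≤ ∞ := WithTop.coe_le_coe.mpr le_top
  have hG := 𝒟.isGloballyHyperbolic
  have hf : ∀ c : 𝒟.carrier, ∃ y, y ∈ 𝒟.metric.chronologicalPast 𝒟.timeOrientation {c} := fun c ↦
    LorentzianMetric.exists_mem_chronologicalPast_singleton hn2 c
  choose f hf using hf
  have hcov : ∀ c ∈ C, 𝒟.metric.chronologicalFuture 𝒟.timeOrientation {f c} ∈ 𝓝 c := fun c _ ↦
    (LorentzianMetric.isOpen_chronologicalFuture_of_boundaryless _ _ {f c}).mem_nhds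
      (LorentzianMetric.mem_chronologicalFuture_of_mem_chronologicalPast (hf c))
  obtain ⟨t, -, htcov⟩ := hC.elim_nhds_subcover
    (fun c ↦ 𝒟.metric.chronologicalFuture 𝒟.timeOrientation {f c}) hcov
  have hsub : 𝒟.metric.causalFuture 𝒟.timeOrientation C ∩ 𝒟.metric.causalPast 𝒟.timeOrientation {x} ⊆
      ⋃ c ∈ t, (𝒟.metric.causalFuture 𝒟.timeOrientation {f c} ∩
        𝒟.metric.causalPast 𝒟.timeOrientation {x}) := by
    rintro y ⟨hyC, hyx⟩
    rw [LorentzianMetric.causalFuture_eq_biUnion] at hyC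
    simp only [mem_iUnion, exists_prop] at hyC ⊢
    obtain ⟨c₀, hc₀, hyc₀⟩ := hyC
    have hc₀' := htcov hc₀
    simp only [mem_iUnion, exists_prop] at hc₀'
    obtain ⟨c, hct, hc₀c⟩ := hc₀'
    exact ⟨c, hct, LorentzianMetric.mem_causalFuture_of_mem_causalFuture_of_mem_causalFuture hn2
      (LorentzianMetric.chronologicalFuture_subset_causalFuture _ _ _ hc₀c) hyc₀, hyx⟩
  have hcpt : IsCompact (⋃ c ∈ t, (𝒟.metric.causalFuture 𝒟.timeOrientation {f c} ∩
      𝒟.metric.causalPast 𝒟.timeOrientation {x})) :=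
    t.isCompact_biUnion fun c _ ↦ hG.2 (f c) x
  exact hcpt.of_isClosed_subset ((hG.isClosed_causalFuture_of_isCompact hn2 hC).inter
    (𝒟.isClosed_causalPast_singleton x)) hsub

/-- Time dual: `J⁻(C) ∩ J⁺(x)` is compact for compact `C` (the same argument for `-τ`, whose
global hyperbolicity is that of `τ`). [cite: HawkingEllis1973CUP, §6.6, Prop. 6.6.6] -/
theorem isCompact_causalPast_inter_causalFuture_of_isCompact (𝒟 : CauchyDevelopment D)
    {C : Set 𝒟.carrier} (hC : IsCompact C) (x : 𝒟.carrier) :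
    IsCompact (𝒟.metric.causalPast 𝒟.timeOrientation C ∩
      𝒟.metric.causalFuture 𝒟.timeOrientation {x}) := by
  classical
  have hn2 : (2 : ℕ∞ω) ≤ ∞ := WithTop.coe_le_coe.mpr le_top
  have hG := 𝒟.isGloballyHyperbolic
  have hGr : 𝒟.metric.IsGloballyHyperbolic 𝒟.timeOrientation.reverse := by
    refine ⟨hG.1.reverse, fun p q ↦ ?_⟩
    have e1 : 𝒟.metric.causalFuture 𝒟.timeOrientation.reverse {p} =
        𝒟.metric.causalPast 𝒟.timeOrientation {p} := rfl
    rw [e1, LorentzianMetric.causalPast_reverse, Set.inter_comm]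
    exact hG.2 q p
  -- points `c ≪ f c`
  have hf : ∀ c : 𝒟.carrier, ∃ y, y ∈ 𝒟.metric.chronologicalFuture 𝒟.timeOrientation {c} := fun c ↦
    LorentzianMetric.exists_mem_chronologicalFuture_singleton hn2 c
  choose f hf using hf
  have hcov : ∀ c ∈ C, 𝒟.metric.chronologicalPast 𝒟.timeOrientation {f c} ∈ 𝓝 c := fun c _ ↦
    (LorentzianMetric.isOpen_chronologicalPast_of_boundaryless _ _ {f c}).mem_nhds
      (LorentzianMetric.mem_chronologicalPast_of_mem_chronologicalFuture (hf c))
  obtain ⟨t, -, htcov⟩ := hC.elim_nhds_subcover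
    (fun c ↦ 𝒟.metric.chronologicalPast 𝒟.timeOrientation {f c}) hcov
  have hsub : 𝒟.metric.causalPast 𝒟.timeOrientation C ∩ 𝒟.metric.causalFuture 𝒟.timeOrientation {x} ⊆
      ⋃ c ∈ t, (𝒟.metric.causalFuture 𝒟.timeOrientation {x} ∩
        𝒟.metric.causalPast 𝒟.timeOrientation {f c}) := by
    rintro y ⟨hyC, hyx⟩
    rw [LorentzianMetric.causalPast, LorentzianMetric.causalFuture_eq_biUnion] at hyC
    simp only [mem_iUnion, exists_prop] at hyC ⊢
    obtain ⟨c₀, hc₀, hyc₀⟩ := hyC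
    have hc₀' := htcov hc₀
    simp only [mem_iUnion, exists_prop] at hc₀'
    obtain ⟨c, hct, hc₀c⟩ := hc₀'
    refine ⟨c, hct, hyx, ?_⟩
    -- `y ≤ c₀ ≪ f c`, so `y ∈ J⁻(f c)`
    have h1 : c₀ ∈ 𝒟.metric.causalFuture 𝒟.timeOrientation {y} :=
      LorentzianMetric.mem_causalPast_singleton_iff.1 hyc₀
    have h2 : f c ∈ 𝒟.metric.causalFuture 𝒟.timeOrientation {c₀} :=
      LorentzianMetric.chronologicalFuture_subset_causalFuture _ _ _
        (LorentzianMetric.mem_chronologicalFuture_of_mem_chronologicalPast hc₀c)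
    exact LorentzianMetric.mem_causalPast_singleton_iff.2
      (LorentzianMetric.mem_causalFuture_of_mem_causalFuture_of_mem_causalFuture hn2 h1 h2)
  have hcpt : IsCompact (⋃ c ∈ t, (𝒟.metric.causalFuture 𝒟.timeOrientation {x} ∩
      𝒟.metric.causalPast 𝒟.timeOrientation {f c})) :=
    t.isCompact_biUnion fun c _ ↦ hG.2 x (f c)
  have hcl : IsClosed (𝒟.metric.causalPast 𝒟.timeOrientation C) :=
    hGr.isClosed_causalFuture_of_isCompact hn2 hC
  exact hcpt.of_isClosed_subset (hcl.inter (𝒟.isClosed_causalFuture_singleton x)) hsub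

/-- **Non-imprisonment, future form used**: in a Cauchy development a future-endless causal curve
leaves every compact set after any given parameter (`IsStronglyCausal.exists_forall_notMem_of_isCompact_holds`,
O'Neill 1983, Lemma 14.13, with the strong causality of Cauchy developments).
[cite: ONeillSemiRiemannian1983, Ch. 14, Lemma 14.13 (p. 407)] -/
theorem exists_ge_notMem_of_isFutureEndless (𝒟 : CauchyDevelopment D) {K : Set 𝒟.carrier}
    (hK : IsCompact K) {γ : ℝ → 𝒟.carrier} {s : Set ℝ} (hs : s.OrdConnected)
    (hγ : 𝒟.metric.IsFutureCausalCurveOn 𝒟.timeOrientation γ s) (hend : IsFutureEndless γ s)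
    {t₀ : ℝ} (ht₀ : t₀ ∈ s) : ∃ t ∈ s, t₀ ≤ t ∧ γ t ∉ K := by
  have hn2 : (2 : ℕ∞ω) ≤ ∞ := WithTop.coe_le_coe.mpr le_top
  obtain ⟨t, ht, hleave⟩ := LorentzianMetric.IsStronglyCausal.exists_forall_notMem_of_isCompact_holds
    hn2 𝒟.isStronglyCausal hK hs hγ hend
  refine ⟨max t₀ t, ?_, le_max_left _ _, hleave _ ?_ (le_max_right _ _)⟩ <;>
  · rcases le_total t₀ t with h | h
    · simp [max_eq_right h, ht]
    · simp [max_eq_left h, ht₀]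

/-- **Non-imprisonment, past form used** (time dual, reading the curve backwards).
[cite: ONeillSemiRiemannian1983, Ch. 14, Lemma 14.13 (p. 407)] -/
theorem exists_le_notMem_of_isPastEndless (𝒟 : CauchyDevelopment D) {K : Set 𝒟.carrier}
    (hK : IsCompact K) {γ : ℝ → 𝒟.carrier} {s : Set ℝ} (hs : s.OrdConnected)
    (hγ : 𝒟.metric.IsFutureCausalCurveOn 𝒟.timeOrientation γ s) (hend : IsPastEndless γ s)
    {t₀ : ℝ} (ht₀ : t₀ ∈ s) : ∃ t ∈ s, t ≤ t₀ ∧ γ t ∉ K := by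
  have hn2 : (2 : ℕ∞ω) ≤ ∞ := WithTop.coe_le_coe.mpr le_top
  have hγ' : 𝒟.metric.IsFutureCausalCurveOn 𝒟.timeOrientation.reverse (fun t ↦ γ (-t))
      (Neg.neg ⁻¹' s) := hγ.comp_neg
  have hend' : IsFutureEndless (fun t ↦ γ (-t)) (Neg.neg ⁻¹' s) :=
    isFutureEndless_comp_neg_iff.2 hend
  obtain ⟨t, ht, hleave⟩ := LorentzianMetric.IsStronglyCausal.exists_forall_notMem_of_isCompact_holds
    hn2 𝒟.isStronglyCausal.reverse hK (ordConnected_preimage_neg hs) hγ' hend'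
  have hm : max (-t₀) t ∈ Neg.neg ⁻¹' s := by
    rcases le_total (-t₀) t with h | h
    · simp only [max_eq_right h]; exact ht
    · simp only [max_eq_left h]; show -(-t₀) ∈ s; rw [neg_neg]; exact ht₀
  refine ⟨-max (-t₀) t, hm, by linarith [le_max_left (-t₀) t], hleave _ hm (le_max_right _ _)⟩

end CauchyDevelopment

end Developments

namespace LorentzianMetric

variable {E : Type*} [NormedAddCommGroup E] [NormedSpace ℝ E] {H : Type*} [TopologicalSpace H]
  {I : ModelWithCorners ℝ E H} {n : ℕ∞ω} {M : Type*} [TopologicalSpace M] [ChartedSpace H M]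
  [IsManifold I ∞ M] [T2Space M] [SecondCountableTopology M] [BoundarylessManifold I M]
  [FiniteDimensional ℝ E] {g : LorentzianMetric I n M} {τ : TimeOrientation g}

/-- **The horismos of a hypersurface which is Cauchy in a neighbourhood is trivial:
`J⁺(S) ⊆ S ∪ I⁺(S)`.** Let `S` be acausal, `V ⊇ S` open with `S` a Cauchy hypersurface of
`(V, g|_V)`, and suppose the causality condition holds. A causal curve `η` from `w ∈ S` to
`x ∉ S` has `η t₁ ∈ V ∖ S` for small `t₁ > a` (a return to `S` would close a causal loop, by
acausality), hence `η t₁ ∈ I⁺_V(S) ∪ I⁻_V(S)`; the second is excluded (`w ≤ η t₁ ≪ s'` gives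
`w ≪ s'` in `S`), and the first gives `x ∈ J⁺(I⁺(S)) = I⁺(S)`. For a smooth spacelike `S` this
is O'Neill 1983, Lemma 14.42 (via Lemma 10.50); here spacelikeness enters through the Cauchy
property of `S` in `V`. [cite: ONeillSemiRiemannian1983, Ch. 14, Lemma 14.42 (p. 425)] -/
theorem causalFuture_subset_union_chronologicalFuture_of_cauchy_nhds (hn : 2 ≤ n)
    (hres : PseudoRiemannianMetric.contMDiff_restrict (I := I) (n := n) (M := M))
    (hτ : τ.contMDiff_restrict) (hcwb : g.IsCausallyWellBehaved τ) {S : Set M}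
    (hac : ∀ p ∈ S, ∀ q ∈ S, q ∈ g.causalFuture τ {p} → q = p) {V : Opens M} (hSV : S ⊆ V)
    (hV : (g.restrict hres V).IsCauchyHypersurface (τ.restrict hres hτ V) (Subtype.val ⁻¹' S)) :
    g.causalFuture τ S ⊆ S ∪ g.chronologicalFuture τ S := by
  have hn1 : (1 : ℕ∞ω) ≤ n := le_trans one_le_two hn
  intro x hx
  by_cases hxS : x ∈ S
  · exact Or.inl hxS
  right
  rcases hx with hx | ⟨w, hw, η, a, b, hab, hη, hηa, hηb⟩
  · exact absurd hx hxS
  -- a parameter `t₁ ∈ (a, b]` with `η t₁ ∈ V`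
  have hcont : ContinuousAt η a := (hη a (left_mem_Icc.2 hab.le)).1.continuousAt
  obtain ⟨ε, hε, hball⟩ := Metric.mem_nhds_iff.1
    (hcont.preimage_mem_nhds (V.isOpen.mem_nhds (by rw [hηa]; exact hSV hw)))
  set t₁ := min (a + ε / 2) b with ht₁
  have hat₁ : a < t₁ := lt_min (by linarith) hab
  have ht₁b : t₁ ≤ b := min_le_right _ _
  have ht₁V : η t₁ ∈ V := hball (by
    rw [Metric.mem_ball, Real.dist_eq, abs_lt]
    constructor <;> linarith [min_le_left (a + ε / 2) b])
  -- `w ≤ η t₁ ≤ x`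
  have hwt₁ : η t₁ ∈ g.causalFuture τ {w} :=
    Or.inr ⟨w, rfl, η, a, t₁, hat₁, hη.mono (Icc_subset_Icc le_rfl ht₁b), hηa, rfl⟩
  have ht₁x : x ∈ g.causalFuture τ {η t₁} := by
    rcases eq_or_lt_of_le ht₁b with heq | hlt
    · rw [← hηb, ← heq]; exact subset_causalFuture g τ _ rfl
    · exact Or.inr ⟨η t₁, rfl, η, t₁, b, hlt, hη.mono (Icc_subset_Icc hat₁.le le_rfl), rfl, hηb⟩
  -- `η t₁ ∉ S` (acausality + causality condition)
  have ht₁S : η t₁ ∉ S := by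
    intro hS
    have heq : η t₁ = w := hac w hw _ hS hwt₁
    exact hcwb η a t₁ hat₁ (hη.mono (Icc_subset_Icc le_rfl ht₁b)) (by rw [hηa, heq])
  -- dichotomy in `V`
  have ht₁S' : (⟨η t₁, ht₁V⟩ : V) ∉ (Subtype.val ⁻¹' S : Set V) := ht₁S
  rcases IsCauchyHypersurface.mem_chronologicalFuture_union_chronologicalPast hn hV ht₁S' with hfut | hpast
  · -- `η t₁ ∈ I⁺(S)`, so `x ∈ I⁺(S)`
    obtain ⟨z, hz, β, a', b', hab', hβ, hβa, hβb⟩ := hfut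
    have hβM : g.IsFutureTimelikeCurveOn τ (Subtype.val ∘ β) (Icc a' b') :=
      (isFutureTimelikeCurveOn_restrict_iff g τ hres hτ _).1 hβ
    have h1 : η t₁ ∈ g.chronologicalFuture τ S :=
      ⟨z, hz, Subtype.val ∘ β, a', b', hab', hβM, by rw [comp_apply, hβa], by rw [comp_apply, hβb]⟩
    exact mem_chronologicalFuture_of_mem_chronologicalFuture_of_mem_causalFuture_set hn1 h1 ht₁x
  · -- `η t₁ ∈ I⁻_V(S)`: some `s' ∈ S` with `w ≤ η t₁ ≪ s'`, against acausality
    exfalso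
    rw [chronologicalPast, chronologicalFuture_eq_biUnion] at hpast
    simp only [mem_iUnion, exists_prop] at hpast
    obtain ⟨z, hz, hzt⟩ := hpast
    obtain ⟨y', hy', β, a', b', hab', hβ, hβa, hβb⟩ := mem_chronologicalFuture_of_mem_chronologicalPast hzt
    rw [mem_singleton_iff] at hy'
    rw [hy'] at hβa
    have hβM : g.IsFutureTimelikeCurveOn τ (Subtype.val ∘ β) (Icc a' b') :=
      (isFutureTimelikeCurveOn_restrict_iff g τ hres hτ _).1 hβ
    have h1 : (z : M) ∈ g.chronologicalFuture τ {η t₁} :=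
      ⟨η t₁, rfl, Subtype.val ∘ β, a', b', hab', hβM, by rw [comp_apply, hβa], by rw [comp_apply, hβb]⟩
    have h2 : (z : M) ∈ g.chronologicalFuture τ {w} := mem_chronologicalFuture_of_mem_causalFuture hn1 hwt₁ h1
    have heq : (z : M) = w := hac w hw z hz (chronologicalFuture_subset_causalFuture g τ _ h2)
    obtain ⟨w', hw', γ, c, d, hcd, hγ, hγc, hγd⟩ := h2
    rw [mem_singleton_iff] at hw'
    exact hcwb.isChronological γ c d hcd hγ (by rw [hγc, hγd, hw', heq])

/-- Time dual: `J⁻(S) ⊆ S ∪ I⁻(S)` under the same hypotheses. [cite: ONeillSemiRiemannian1983, Ch. 14, Lemma 14.42 (p. 425)] -/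
theorem causalPast_subset_union_chronologicalPast_of_cauchy_nhds (hn : 2 ≤ n)
    (hres : PseudoRiemannianMetric.contMDiff_restrict (I := I) (n := n) (M := M))
    (hτ : τ.contMDiff_restrict) (hcwb : g.IsCausallyWellBehaved τ) {S : Set M}
    (hac : ∀ p ∈ S, ∀ q ∈ S, q ∈ g.causalFuture τ {p} → q = p) {V : Opens M} (hSV : S ⊆ V)
    (hV : (g.restrict hres V).IsCauchyHypersurface (τ.restrict hres hτ V) (Subtype.val ⁻¹' S)) :
    g.causalPast τ S ⊆ S ∪ g.chronologicalPast τ S := by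
  have hτ' : τ.reverse.contMDiff_restrict := τ.contMDiff_restrict_reverse hτ
  have hV' : (g.restrict hres V).IsCauchyHypersurface (τ.reverse.restrict hres hτ' V)
      (Subtype.val ⁻¹' S) := by
    rw [← TimeOrientation.restrict_reverse]
    exact hV.reverse
  have hac' : ∀ p ∈ S, ∀ q ∈ S, q ∈ g.causalFuture τ.reverse {p} → q = p :=
    fun p hp q hq h ↦ (hac q hq p hp (mem_causalPast_singleton_iff.1 h)).symm
  exact causalFuture_subset_union_chronologicalFuture_of_cauchy_nhds (τ := τ.reverse) hn hres hτ'
    hcwb.reverse hac' hSV hV'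

end LorentzianMetric

end Literature.Geometry.Lorentzian

end
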